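import Summits.AnomalousDissipation.AnomalousDissipation.Theses.TameRoughRigidity
import Summits.AnomalousDissipation.AnomalousDissipation.Theorems.TameToRough.Negative.Structure
import Summits.AnomalousDissipation.AnomalousDissipation.Theorems.TameRoughRigidityTameClosure
import HarnessLib

/-!
# `TameRoughRigidity.TameToRough` (stmt-AnomalousDissipation-18401) is the residual of the target modulo N —
# the parking certificate of line `Sketch`

Continuation lead c1 of the crux R = `TameToRough` (conditional Onsager calibration for the Galloway–Proctor
force `f_GP`). The refuter's structure theorem `TameToRough.Negative.tameToRough_iff_imp : R ↔ (N → K → X)`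
(N = `GPEulerCoercive`, K = `TameClosure`, X = `GPStatisticalRigidity`, the route target stmt-15508) and the
LANDED closure lemma K (`TameClosure.TameClosure_of`, stmt-18402) combine to the two-variable normal form recorded
here as named, citeable facts:

* `tameToRough_of_target` — **X → R**: the crux closes by this one-liner the moment the target lands
  (the `blocked-on: stmt-AnomalousDissipation-15508` certificate of this line);
* `gpEulerCoercive_of_target` — **X → N** (an Euler stationary statistical solution of `f_GP` is an exact
  statistics at its own energy level, where X with `R = 0` is absurd; cf. `Negative/EulerSSS` for the parent decl);
* `tameToRough_iff_coercive_imp_target` — **R ↔ (N → X)**: with K proved, R is EXACTLY the target conditioned on N;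
* `target_iff_coercive_and_tameToRough` — **X ↔ (N ∧ R)**: the target splits into the existence crux N
  (stmt-18400) and R with nothing left over, so a proof of the line's open stub S2 (`stub_coSignedFloor`, kernel-
  equivalent to R by the landed `coSignedFloor_iff_tameToRough`, p162200) is a proof of X under N and conversely.

The file ends with the registered conjunction `stub_residualFormTools`. Nothing here asserts a Theses statement.

## References

* C. Foias, O. Manley, R. Rosa, R. Temam, *Navier–Stokes Equations and Turbulence*, CUP (2001), Ch. IV §1.2
  Def. 1.3 (stationary statistical solutions; the `ν = 0` class). [FoiasManleyRosaTemam2001]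
* `Theorems/TameToRough/Negative/Structure.lean` (p143720), `Theorems/TameRoughRigidityTameClosure.lean`,
  `Theorems/TameRoughRigidityTameToRoughWitnessForm.lean` (p162200), `Cruxes/TameToRough/{PICKED.md, STRATEGY-CENSUS.md}`.
-/

set_option linter.dupNamespace false

noncomputable section

namespace Summit.AnomalousDissipation.AnomalousDissipation.Theorems.TameRoughRigidity.TameToRough

open MeasureTheory
open Literature.Analysis.FunctionSpaces Literature.Analysis.FluidPDE
open Summit.AnomalousDissipation.AnomalousDissipation.Theses.TameRoughRigidity
open Summit.AnomalousDissipation.AnomalousDissipation.Theorems.GPStatisticalRigidity.Negative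
open Summit.AnomalousDissipation.AnomalousDissipation.Theorems.TameToRough.Negative

/-- **X → N.** The target forbids every stationary statistical solution of Euler forced by `f_GP`: such a `μ` is
an exact statistics (`exactEulerStatistics_of_sss`: probability, integrable energy, finite enstrophy, shell work
`≥ 0`, vanishing cylindrical defect), and X at the level `E = e(μ)` with `R = 0` would give `0 < c ≤ 0`. -/
theorem gpEulerCoercive_of_target (hX : GPStatisticalRigidity) : GPEulerCoercive := by
  intro f hf μ hμ
  subst hf
  have hex := exactEulerStatistics_of_sss hμ
  obtain ⟨c, δ₀, hc, hδ₀, hall⟩ := hX gpForce rfl (Torus.ensembleEnergy μ)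
  have key := hall μ hex.1 hex.2.1 le_rfl hex.2.2.1 hex.2.2.2.1 0 le_rfl hδ₀.le (defectLE_of_exact hex le_rfl)
  rw [zero_mul] at key
  exact absurd key (not_le.mpr hc)

/-- **X → R** (parking certificate). The target gives the crux outright: under R's antecedent nothing is needed
but X's constants with threshold `G₁ = 0` (`tameToRough_iff_imp`, ← direction). When stmt-15508 lands as
`h : GPStatisticalRigidity`, `TameToRough` is `tameToRough_of_target h`. -/
theorem tameToRough_of_target (hX : GPStatisticalRigidity) : TameToRough :=
  tameToRough_iff_imp.2 fun _ _ => hX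

/-- **R ↔ (N → X).** With the closure lemma K = `TameClosure` PROVED (`TameClosure.TameClosure_of`), the crux is
exactly the target conditioned on the existence crux N = `GPEulerCoercive`. -/
theorem tameToRough_iff_coercive_imp_target : TameToRough ↔ (GPEulerCoercive → GPStatisticalRigidity) := by
  rw [tameToRough_iff_imp]
  exact ⟨fun h hN => h hN TameClosure.TameClosure_of, fun h hN _ => h hN⟩

/-- **X ↔ (N ∧ R).** The target is the conjunction of the existence crux N and the calibration crux R, with no
remainder: `→` by `gpEulerCoercive_of_target` and `tameToRough_of_target`, `←` by `tameToRough_iff_coercive_imp_target`. -/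
theorem target_iff_coercive_and_tameToRough : GPStatisticalRigidity ↔ (GPEulerCoercive ∧ TameToRough) :=
  ⟨fun hX => ⟨gpEulerCoercive_of_target hX, tameToRough_of_target hX⟩,
    fun h => tameToRough_iff_coercive_imp_target.1 h.2 h.1⟩

/-! ### The registered conjunction -/

/-- **`stub_residualFormTools`** — `(X → R) ∧ (X → N) ∧ (R ↔ (N → X)) ∧ (X ↔ (N ∧ R))`, as registered on the crux. -/
theorem stub_residualFormTools :
    (GPStatisticalRigidity → TameToRough) ∧ (GPStatisticalRigidity → GPEulerCoercive) ∧
      (TameToRough ↔ (GPEulerCoercive → GPStatisticalRigidity)) ∧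
      (GPStatisticalRigidity ↔ (GPEulerCoercive ∧ TameToRough)) :=
  ⟨tameToRough_of_target, gpEulerCoercive_of_target, tameToRough_iff_coercive_imp_target,
    target_iff_coercive_and_tameToRough⟩

end Summit.AnomalousDissipation.AnomalousDissipation.Theorems.TameRoughRigidity.TameToRough

end
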